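import Summits.HubbardSuperconductivity.HubbardLadder.NeelSignAxisRPMinor
import HarnessLib

/-!
# The strict Néel sign on the WHOLE odd axis, uniformly in the torus side: `c_{2k}(0, 2M+1) ≤ -q_M < 0` for every `M` (HubbardLadder R2, device D53-K1)

HONEST FRAMING: ladder R1–R4 with certified numbers; no claim on H/H₀.  Reference model only: the spin-½
Heisenberg antiferromagnet on the even torus `(ℤ/2kℤ)²`; a family of WEAK, `k`-uniform SIGN statements at
(doubly-exponentially) tiny margins — not Néel order, nothing about the Hubbard model.

`NeelSignAxisRPMinor.lean` (pseudo F30 / r2) certified the axis cells `(0,5), (0,7), (0,9)` one at a time from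
`2 × 2` principal minors of the reflection-positivity Gram form `[-c(i+i'+1, t-t')] ⪰ 0`
(`heis_rpGramWindow_range`, Dyson–Lieb–Simon Thm 4.2 / Kennedy–Lieb–Shastry eq. (25)).  This file proves the
GENERAL two-row minor once (`heis_rpTwoRowMinor_axis`: for rows `i ≠ j < k` and reals `a, b`,
`0 ≤ -a² c(2i+1,0) - 2ab c(i+j+1,0) - b² c(2j+1,0)` on the torus of side `2k`) and runs the recursion of the cell
record (STRUCTURE.md §1A C7) as a strong induction on `M`:

* `M = 0, 1`: the landed rows `c_L(0,1) ≤ -1/12`, `c_L(0,3) ≤ -17/10⁴` (`NeelSignPatternAllEven`, every even `L ≥ 4`);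
* `M ≥ 2` even: rows `{0, M}` give `c(1)·c(2M+1) ≥ c(M+1)²`, and `M+1 = 2(M/2)+1` is a smaller odd distance;
* `M ≥ 3` odd: rows `{1, M}` give `c(3)·c(2M+1) ≥ c(M+2)²`, and `M+2 = 2((M+1)/2)+1` is a smaller odd distance;

with the box `c ≥ -1/4` (`heisRedCorr2_abs_le`) on the diagonal entry, a source margin `q` yields the target
margin `4q²` (test vector `(4q, -1)`).  Result (`heisRedCorr2_oddAxis_uniform`): for every `M` there are a rational
`q > 0` and a `k₀ ≥ 1` with `c_{2k}(0,2M+1) ≤ -q` for all `k ≥ k₀` — i.e. the cells `(0,2M+1)` and `(2M+1,0)` of the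
typed conjecture (S) `Summit.HubbardSuperconductivity.Conjectures.NeelSignUniform` hold for EVERY `M`
— stated in (S)'s body verbatim as `heisRedCorr2_oddAxis_neelSign` / `_swap` (margins existential: `< 10⁻¹⁷` beyond
`(0,9)`, see there).  Everything is proved; no named facts, no numerical input, zero kit.
[cite: DLS1978, Theorem 4.2] [cite: KLS1988JSP, eq. (25)]
-/

noncomputable section

namespace Summit.HubbardSuperconductivity.HubbardLadder

open Finset Literature.MathematicalPhysics.QuantumLattice Literature.Probability.LatticeModels

/-- **General two-row reflection-positivity minor on the axis rung.**  On the torus of side `2k`, for two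
distinct window rows `i, j < k` and any reals `a, b`:
`0 ≤ a²·(-c(2i+1,0)) + 2ab·(-c(i+j+1,0)) + b²·(-c(2j+1,0))` — the Gram form `heis_rpGramWindow_range` at the
test vector `a·e_i + b·e_j` on the one-rung window.  [cite: DLS1978, Theorem 4.2] [cite: KLS1988JSP, eq. (25)] -/
theorem heis_rpTwoRowMinor_axis (k i j : ℕ) (hij : i ≠ j) (hi : i < k) (hj : j < k) (a b : ℝ) :
    haveI : NeZero (2 * k) := ⟨by omega⟩
    0 ≤ a ^ 2 * -heisRedCorr2 (2 * k) 1 (2 * i + 1) 0 + 2 * a * b * -heisRedCorr2 (2 * k) 1 (i + j + 1) 0 +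
      b ^ 2 * -heisRedCorr2 (2 * k) 1 (2 * j + 1) 0 := by
  haveI : NeZero (2 * k) := ⟨by omega⟩
  -- the window: `m = max i j + 1 ≤ k` rows, one rung
  have hmk : max i j + 1 ≤ k := by omega
  have hG := heis_rpGramWindow_range k 1 (max i j + 1) 1 hmk
    (fun x _ => if x = i then a else if x = j then b else 0)
  simp only [sum_range_one, Nat.cast_zero, sub_self, Int.natAbs_zero] at hG
  -- the two-point support collapses every window sum
  have key : ∀ f : ℕ → ℝ,
      ∑ x ∈ range (max i j + 1), (if x = i then a else if x = j then b else 0) * f x = a * f i + b * f j := by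
    intro f
    rw [sum_eq_add_of_mem i j (mem_range.mpr (by omega)) (mem_range.mpr (by omega)) hij]
    · simp [hij.symm]
    · intro c _ hc
      simp [hc.1, hc.2]
  have inner : ∀ x : ℕ, ∑ y ∈ range (max i j + 1),
      (if x = i then a else if x = j then b else 0) * (if y = i then a else if y = j then b else 0) *
        -heisRedCorr2 (2 * k) 1 (x + y + 1) 0 =
      (if x = i then a else if x = j then b else 0) *
        (a * -heisRedCorr2 (2 * k) 1 (x + i + 1) 0 + b * -heisRedCorr2 (2 * k) 1 (x + j + 1) 0) := by
    intro x
    rw [← key (fun y => -heisRedCorr2 (2 * k) 1 (x + y + 1) 0), mul_sum]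
    exact sum_congr rfl fun y _ => by ring
  simp_rw [inner] at hG
  rw [key] at hG
  have e1 : i + i + 1 = 2 * i + 1 := by ring
  have e2 : j + j + 1 = 2 * j + 1 := by ring
  have e3 : j + i + 1 = i + j + 1 := by ring
  simp only [e1, e2, e3] at hG
  nlinarith [hG]

/-- **The odd axis of the Néel sign pattern, uniformly in the side** (STRUCTURE.md §1A C7 as ONE theorem): for every
`M` there are a rational margin `q > 0` and a threshold `k₀ ≥ 1` such that `c_{2k}(0, 2M+1) ≤ -q` on EVERY torus of
side `2k`, `k ≥ k₀`.  Margins: `1/12` (`M = 0`), `17/10⁴` (`M = 1`), then `q_M = 4·q_{source}²` along the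
reflection-positivity recursion (source distance `M+1` resp. `M+2`); thresholds `k₀ = max(k₀(source), M+1, 2)`.
HONEST FRAMING: ladder R1–R4 with certified numbers; no claim on H/H₀. [cite: DLS1978, Theorem 4.2] [cite: KLS1988JSP, eq. (25)] -/
theorem heisRedCorr2_oddAxis_uniform (M : ℕ) :
    ∃ q : ℚ, 0 < q ∧ ∃ k₀ : ℕ, 1 ≤ k₀ ∧ ∀ k : ℕ, k₀ ≤ k →
      heisRedCorr2 (2 * k) 1 0 (2 * M + 1) ≤ -(q : ℝ) := by
  induction M using Nat.strong_induction_on with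
  | _ M ih =>
    rcases Nat.lt_or_ge M 2 with hM2 | hM2
    · interval_cases M
      · refine ⟨1 / 12, by norm_num, 2, by norm_num, fun k hk => ?_⟩
        have h := heisRedCorr2_C01_ceiling_allEven (2 * k) (by omega) (even_two_mul k)
        push_cast
        linarith
      · refine ⟨17 / 10000, by norm_num, 2, by norm_num, fun k hk => ?_⟩
        have h := heisRedCorr2_C03_ceiling_allEven (2 * k) (by omega) (even_two_mul k)
        push_cast
        linarith
    · rcases Nat.even_or_odd M with ⟨r, hr⟩ | ⟨r, hr⟩
      · -- `M = r + r ≥ 2`: source distance `M + 1 = 2r + 1`, rows `{0, M}`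
        obtain ⟨q, hq, k₁, hk₁, hsrc⟩ := ih r (by omega)
        refine ⟨4 * q ^ 2, by positivity, max k₁ (M + 1), by omega, fun k hk => ?_⟩
        haveI : NeZero (2 * k) := ⟨by omega⟩
        have hs := hsrc k (le_trans (le_max_left _ _) hk)
        have hmin := heis_rpTwoRowMinor_axis k 0 M (by omega) (by omega) (by omega) (4 * (q : ℝ)) (-1)
        have hbox := (abs_le.mp (heisRedCorr2_abs_le (2 * k) 1 (2 * 0 + 1) 0)).1
        have esrc : heisRedCorr2 (2 * k) 1 (0 + M + 1) 0 = heisRedCorr2 (2 * k) 1 0 (2 * r + 1) := by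
          rw [heisRedCorr2_swap]; congr 1; omega
        have etgt : heisRedCorr2 (2 * k) 1 (2 * M + 1) 0 = heisRedCorr2 (2 * k) 1 0 (2 * M + 1) := by
          rw [heisRedCorr2_swap]
        rw [esrc, etgt] at hmin
        have hqR : (0 : ℝ) < q := by exact_mod_cast hq
        push_cast
        norm_num at hbox
        nlinarith [mul_nonneg hqR.le (by linarith : (0 : ℝ) ≤ -(q : ℝ) - heisRedCorr2 (2 * k) 1 0 (2 * r + 1)),
          mul_nonneg (sq_nonneg (q : ℝ)) (by linarith : (0 : ℝ) ≤ heisRedCorr2 (2 * k) 1 (2 * 0 + 1) 0 + 1 / 4)]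
      · -- `M = 2r + 1 ≥ 3`: source distance `M + 2 = 2(r+1) + 1`, rows `{1, M}`
        obtain ⟨q, hq, k₁, hk₁, hsrc⟩ := ih (r + 1) (by omega)
        refine ⟨4 * q ^ 2, by positivity, max k₁ (M + 1), by omega, fun k hk => ?_⟩
        haveI : NeZero (2 * k) := ⟨by omega⟩
        have hs := hsrc k (le_trans (le_max_left _ _) hk)
        have hmin := heis_rpTwoRowMinor_axis k 1 M (by omega) (by omega) (by omega) (4 * (q : ℝ)) (-1)
        have hbox := (abs_le.mp (heisRedCorr2_abs_le (2 * k) 1 (2 * 1 + 1) 0)).1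
        have esrc : heisRedCorr2 (2 * k) 1 (1 + M + 1) 0 = heisRedCorr2 (2 * k) 1 0 (2 * (r + 1) + 1) := by
          rw [heisRedCorr2_swap]; congr 1; omega
        have etgt : heisRedCorr2 (2 * k) 1 (2 * M + 1) 0 = heisRedCorr2 (2 * k) 1 0 (2 * M + 1) := by
          rw [heisRedCorr2_swap]
        rw [esrc, etgt] at hmin
        have hqR : (0 : ℝ) < q := by exact_mod_cast hq
        push_cast
        norm_num at hbox
        nlinarith [mul_nonneg hqR.le (by linarith : (0 : ℝ) ≤ -(q : ℝ) - heisRedCorr2 (2 * k) 1 0 (2 * (r + 1) + 1)),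
          mul_nonneg (sq_nonneg (q : ℝ)) (by linarith : (0 : ℝ) ≤ heisRedCorr2 (2 * k) 1 (2 * 1 + 1) 0 + 1 / 4)]

/-- The odd axis in the orientation `(2M+1, 0)` as well (lattice symmetry `heisRedCorr2_swap`).
HONEST FRAMING: ladder R1–R4 with certified numbers; no claim on H/H₀. [cite: KLS1988JSP, eq. (25)] -/
theorem heisRedCorr2_oddAxis_uniform_swap (M : ℕ) :
    ∃ q : ℚ, 0 < q ∧ ∃ k₀ : ℕ, 1 ≤ k₀ ∧ ∀ k : ℕ, k₀ ≤ k →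
      heisRedCorr2 (2 * k) 1 (2 * M + 1) 0 ≤ -(q : ℝ) := by
  obtain ⟨q, hq, k₀, hk₀, h⟩ := heisRedCorr2_oddAxis_uniform M
  refine ⟨q, hq, k₀, hk₀, fun k hk => ?_⟩
  haveI : NeZero (2 * k) := ⟨by omega⟩
  rw [heisRedCorr2_swap]
  exact h k hk

/-- **The odd-axis cells of the typed conjecture (S), in its body VERBATIM** (`NeelSignUniform`'s matrix
`∃ q : ℚ, 0 < q ∧ ∃ k₀, ∀ k, k₀ ≤ k → (q : ℝ) ≤ (-1) ^ (a + b) * heisRedCorr2 (2 * k) 1 a b` at `a = 0`, `b = 2M+1`),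
for EVERY `M`; the shell corollaries of `NeelSignUniformShells.lean` close by `exact`.  WHAT THE FAMILY BUYS, honestly:
the strict SIGN and its uniformity in the side at every odd axis distance — NOT usable constants.  The margins are
existential and the recursion squares them (`q_M = 4·q_source²`): `1/12` (`M = 0`), `17/10⁴` (`M = 1`), `≈1.2·10⁻⁵`
(`M = 2`), `≈5.3·10⁻¹⁰` (`M = 3, 4`), `≈1.1·10⁻¹⁸` (`5 ≤ M ≤ 8`), `≈5·10⁻³⁶` (`9 ≤ M ≤ 16`), …; beyond `(0,9)` they are
`< 10⁻¹⁷`.  The one-cell rows of record keep the better constants where they exist (`(0,5) ≤ -23/10⁶`,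
`(0,7) ≤ -2·10⁻⁹`, `(0,9) ≤ -4·10⁻⁹`, `NeelSignAxisRPMinor.lean`).  HONEST FRAMING: ladder R1–R4 with certified numbers;
no claim on H/H₀. [cite: DLS1978, Theorem 4.2] [cite: KLS1988JSP, eq. (25)] -/
theorem heisRedCorr2_oddAxis_neelSign (M : ℕ) :
    ∃ q : ℚ, 0 < q ∧ ∃ k₀ : ℕ, ∀ k : ℕ, k₀ ≤ k →
      (q : ℝ) ≤ (-1 : ℝ) ^ (0 + (2 * M + 1)) * heisRedCorr2 (2 * k) 1 0 (2 * M + 1) := by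
  obtain ⟨q, hq, k₀, _, h⟩ := heisRedCorr2_oddAxis_uniform M
  refine ⟨q, hq, k₀, fun k hk => ?_⟩
  have hodd : Odd (0 + (2 * M + 1)) := ⟨M, by ring⟩
  rw [hodd.neg_one_pow, neg_one_mul]
  have := h k hk
  linarith

/-- The transposed odd-axis cells `(2M+1, 0)` of (S), body verbatim.  HONEST FRAMING: ladder R1–R4 with certified
numbers; no claim on H/H₀. [cite: KLS1988JSP, eq. (25)] -/
theorem heisRedCorr2_oddAxis_neelSign_swap (M : ℕ) :
    ∃ q : ℚ, 0 < q ∧ ∃ k₀ : ℕ, ∀ k : ℕ, k₀ ≤ k →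
      (q : ℝ) ≤ (-1 : ℝ) ^ ((2 * M + 1) + 0) * heisRedCorr2 (2 * k) 1 (2 * M + 1) 0 := by
  obtain ⟨q, hq, k₀, _, h⟩ := heisRedCorr2_oddAxis_uniform_swap M
  refine ⟨q, hq, k₀, fun k hk => ?_⟩
  have hodd : Odd ((2 * M + 1) + 0) := ⟨M, by ring⟩
  rw [hodd.neg_one_pow, neg_one_mul]
  have := h k hk
  linarith

end Summit.HubbardSuperconductivity.HubbardLadder

end
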